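import Summits.QuantumFields.BalabanUV.T4Continuum.Support.NE7K1LinCovEnergyAbstract

/-!
# NE7K1LinCovDecayAbstract — row NE7 (node U5), candidate route HOM, path H1L, cell K1-lin(s): NEEDS-ESTIMATE #E1 (o2) — B4 (2.37) FOR AN ABSTRACT
# FINE OPERATOR `T` IN AN ABSTRACT PSEUDO-DISTANCE: entry bounds of `Δ_T = aI − a²Q_nT⁻¹Q_n^*` from a block-row bound on `T⁻¹`, b04's
# condition (5.6) for `Δ_T + a₂L_P^{−2}P`, and the Combes–Thomas decay of its inverse (`B4Sect5Torus.inv_decay` BY NAME)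

Lineage `b2b-balaban-t4-ne7-p2` (CRUX PROVER NE7 #2), generation 77; file 83b (the decay half of file 83 `NE7K1LinCovEnergyAbstract`, split for the
400-line rule).  Given: the three clauses on `T` of file 83 (`T·T⁻¹ = 1`, symmetry, the Löwner lever `⟨g, boxOpR(n,a,0)g⟩ ≤ ⟨g, Tg⟩`), a pseudo-distance
`ρ` on the unit sites with `ρ(y,y′) ≤ |y − y′|_∞` and a lattice-sum profile `K`, and a block-row bound `|Σ_{x′ ∈ B(y′)} T⁻¹(x,x′)| ≤ C·e^{−κρ(blk x, y′)}`:
`blockSumG_bound`, **`KeffG_entry_bound`** (`|Δ_T(y,y′)| ≤ (a + a²C)e^{−κρ(y,y′)}`), **`covOpG_hyp56`** (constants `γ₀(d,ℓ,a₋,a₂₋)`,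
`c₀ = |a₊| + a₊²C + |a₂₊|e^{κℓ}`, rate `κ`), **`covOpG_inv_decay`**: `|(Δ_T + a₂L_P^{−2}P)⁻¹(y,y′)| ≤ (2∕γ₀)·e^{−rate(K,γ₀,c₀,κ)·ρ(y,y′)}`.
The box (`ρ = |·−·|_∞`, file 81) and the torus (`ρ` = torus sup-distance, file 84) are instances.

HONEST FRAMING: [folklore]; b04's `B4BoxCov237` §6–§7 re-typed over hypotheses; no instance here; nothing of Bałaban's asserted; no `sorry`.  Census
only; NE7 NOT PRINTED ∕ NOT PROVED; spine 0∕9; FIXED FINITE T⁴, rung (B)+1; NOT infinite volume, NOT mass gap, NOT Clay.  HONEST DEPENDENCY: continuum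
YM on T⁴ ⇐ BetaPertH ∧ nine spine estimates (0/9 proved); BetaPertH ⇐ (D1) ∧ (D4) ∧ CAP+tail; G-an2-4 gates asym, D1 and NE2/3/4.
-/

noncomputable section

open Finset Matrix

namespace Summit.QuantumFields.BalabanUV.T4Continuum.NE7K1LinCovDecayAbstract

open Literature.MathematicalPhysics.QuantumFieldTheory.Balaban1983to89
open Literature.MathematicalPhysics.QuantumFieldTheory.Balaban1983to89.B4Reflection242
open Literature.MathematicalPhysics.QuantumFieldTheory.Balaban1983to89.B4ContourShift (supNorm supNorm_nonneg)
open Literature.MathematicalPhysics.QuantumFieldTheory.Balaban1983to89.B4BoxCov237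
open Literature.MathematicalPhysics.QuantumFieldTheory.Balaban1983to89.B4Sect5Torus (IsPseudoDist SumBound Hyp56 rate rate_pos
  inv_decay)
open NE7K1LinCovEnergyAbstract

variable {d : ℕ}

/-! ### §3 Entry bounds and Combes–Thomas decay over a pseudo-distance dominated by the sup-distance -/

section Decay

variable {n : ℕ} {M : Fin (d + 1) → ℕ} (T : Matrix ↥(boxDom fun i => n * M i) ↥(boxDom fun i => n * M i) ℝ)

/-- **BLOCK–BLOCK SUMS**: a block-row bound for `T⁻¹` in the pseudo-distance `ρ` gives
`|(indB·T⁻¹·indBᵀ)(y,y′)| ≤ N·C·e^{−κρ(y,y′)}`. [folklore] -/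
theorem blockSumG_bound (hn : 1 ≤ n) {ρ : ↥(boxDom M) → ↥(boxDom M) → ℝ} {C κ : ℝ}
    (hrow : ∀ (x : ↥(boxDom fun i => n * M i)) (y y' : ↥(boxDom M)), blk n x.1 = y.1 →
      |∑ x' ∈ Finset.univ.filter (fun x' : ↥(boxDom fun i => n * M i) => blk n x'.1 = y'.1), T⁻¹ x x'|
        ≤ C * Real.exp (-(κ * ρ y y')))
    (y y' : ↥(boxDom M)) :
    |(indB n M * T⁻¹ * (indB n M)ᵀ) y y'| ≤ (n : ℝ) ^ (d + 1) * C * Real.exp (-(κ * ρ y y')) := by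
  rw [indB_mul_mul_transpose_apply]
  calc |∑ x ∈ Finset.univ.filter (fun x : ↥(boxDom fun i => n * M i) => blk n x.1 = y.1),
          ∑ x' ∈ Finset.univ.filter (fun x' : ↥(boxDom fun i => n * M i) => blk n x'.1 = y'.1), T⁻¹ x x'|
      ≤ ∑ x ∈ Finset.univ.filter (fun x : ↥(boxDom fun i => n * M i) => blk n x.1 = y.1),
          |∑ x' ∈ Finset.univ.filter (fun x' : ↥(boxDom fun i => n * M i) => blk n x'.1 = y'.1), T⁻¹ x x'| :=
        Finset.abs_sum_le_sum_abs _ _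
    _ ≤ ∑ _x ∈ Finset.univ.filter (fun x : ↥(boxDom fun i => n * M i) => blk n x.1 = y.1), C * Real.exp (-(κ * ρ y y')) :=
        Finset.sum_le_sum fun x hx => hrow x y y' (Finset.mem_filter.1 hx).2
    _ = (n : ℝ) ^ (d + 1) * C * Real.exp (-(κ * ρ y y')) := by
        rw [Finset.sum_const, card_filter_blk hn M y, nsmul_eq_mul]
        push_cast
        ring

/-- **ENTRIES OF `Δ_T` DECAY IN `ρ`**: `|Δ_T(y,y′)| ≤ (a + a²C)e^{−κρ(y,y′)}` (the diagonal uses `ρ(y,y) = 0`). [folklore] -/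
theorem KeffG_entry_bound (hn : 1 ≤ n) {ρ : ↥(boxDom M) → ↥(boxDom M) → ℝ} (hρ : IsPseudoDist ρ) {C κ a : ℝ}
    (ha : 0 < a)
    (hrow : ∀ (x : ↥(boxDom fun i => n * M i)) (y y' : ↥(boxDom M)), blk n x.1 = y.1 →
      |∑ x' ∈ Finset.univ.filter (fun x' : ↥(boxDom fun i => n * M i) => blk n x'.1 = y'.1), T⁻¹ x x'|
        ≤ C * Real.exp (-(κ * ρ y y')))
    (y y' : ↥(boxDom M)) :
    |KeffG n M a T y y'| ≤ (a + a ^ 2 * C) * Real.exp (-(κ * ρ y y')) := by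
  have hn0 : (0 : ℝ) < n := by exact_mod_cast hn
  have hG := blockSumG_bound T hn hrow y y'
  have hE : 0 < Real.exp (-(κ * ρ y y')) := Real.exp_pos _
  have hentry : KeffG n M a T y y' = a * (if y = y' then (1 : ℝ) else 0)
      - a ^ 2 * ((n : ℝ) ^ (d + 1))⁻¹ * (indB n M * T⁻¹ * (indB n M)ᵀ) y y' := by
    simp only [KeffG, Matrix.sub_apply, Matrix.smul_apply, Matrix.one_apply, smul_eq_mul]
  have h2 : |a ^ 2 * ((n : ℝ) ^ (d + 1))⁻¹ * (indB n M * T⁻¹ * (indB n M)ᵀ) y y'| ≤ a ^ 2 * C * Real.exp (-(κ * ρ y y')) := by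
    rw [abs_mul, abs_of_nonneg (by positivity : (0 : ℝ) ≤ a ^ 2 * ((n : ℝ) ^ (d + 1))⁻¹)]
    have hN : (n : ℝ) ^ (d + 1) ≠ 0 := by positivity
    calc a ^ 2 * ((n : ℝ) ^ (d + 1))⁻¹ * |(indB n M * T⁻¹ * (indB n M)ᵀ) y y'|
        ≤ a ^ 2 * ((n : ℝ) ^ (d + 1))⁻¹ * ((n : ℝ) ^ (d + 1) * C * Real.exp (-(κ * ρ y y'))) :=
          mul_le_mul_of_nonneg_left hG (by positivity)
      _ = a ^ 2 * C * Real.exp (-(κ * ρ y y')) := by field_simp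
  have h1 : |a * (if y = y' then (1 : ℝ) else 0)| ≤ a * Real.exp (-(κ * ρ y y')) := by
    by_cases hyy : y = y'
    · subst hyy
      rw [if_pos rfl, mul_one, abs_of_pos ha, hρ.zero, mul_zero, neg_zero, Real.exp_zero, mul_one]
    · rw [if_neg hyy, mul_zero, abs_zero]
      positivity
  rw [hentry]
  calc |a * (if y = y' then (1 : ℝ) else 0) - a ^ 2 * ((n : ℝ) ^ (d + 1))⁻¹ * (indB n M * T⁻¹ * (indB n M)ᵀ) y y'|
      ≤ |a * (if y = y' then (1 : ℝ) else 0)| + |a ^ 2 * ((n : ℝ) ^ (d + 1))⁻¹ * (indB n M * T⁻¹ * (indB n M)ᵀ) y y'| :=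
        abs_sub _ _
    _ ≤ a * Real.exp (-(κ * ρ y y')) + a ^ 2 * C * Real.exp (-(κ * ρ y y')) := add_le_add h1 h2
    _ = (a + a ^ 2 * C) * Real.exp (-(κ * ρ y y')) := by ring

end Decay

section DecayCov

variable {n ℓ : ℕ} {M' : Fin (d + 1) → ℕ}
  (T : Matrix ↥(boxDom fun i => n * ((ℓ + 1) * M' i)) ↥(boxDom fun i => n * ((ℓ + 1) * M' i)) ℝ)

/-- **CONDITION (5.6) FOR `Δ_T + a₂L_P^{−2}P` IN THE PSEUDO-DISTANCE `ρ ≤ |·−·|_∞`** with window-uniform constants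
`γ₀ = γ₀(d,ℓ,a₋,a₂₋)`, `c₀ = |a₊| + a₊²C + |a₂₊|e^{κℓ}`, rate `κ`. [folklore] -/
theorem covOpG_hyp56 (hn : 1 ≤ n) (hℓ : 1 ≤ ℓ) {ρ : ↥(boxDom fun i => (ℓ + 1) * M' i) → ↥(boxDom fun i => (ℓ + 1) * M' i) → ℝ}
    (hρ : IsPseudoDist ρ) (hρle : ∀ y y', ρ y y' ≤ supNorm (y.1 - y'.1)) {C κ : ℝ} (hC : 0 ≤ C) (hκ : 0 < κ)
    {aminus aplus a2minus a2plus a a₂ : ℝ} (ham : 0 < aminus) (h1 : aminus ≤ a) (h2 : a ≤ aplus) (ha2m : 0 < a2minus)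
    (h5 : a2minus ≤ a₂) (h6 : a₂ ≤ a2plus) (hTs : T.IsSymm) (hTG : T * T⁻¹ = 1)
    (hlev : ∀ g, g ⬝ᵥ (boxOpR n a 0 (fun i => (ℓ + 1) * M' i)).mulVec g ≤ g ⬝ᵥ T.mulVec g)
    (hrow : ∀ (x : ↥(boxDom fun i => n * ((ℓ + 1) * M' i))) (y y' : ↥(boxDom fun i => (ℓ + 1) * M' i)), blk n x.1 = y.1 →
      |∑ x' ∈ Finset.univ.filter (fun x' : ↥(boxDom fun i => n * ((ℓ + 1) * M' i)) => blk n x'.1 = y'.1), T⁻¹ x x'|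
        ≤ C * Real.exp (-(κ * ρ y y'))) :
    Hyp56 ρ (covOpG n ℓ M' a a₂ T)
      (min (min (aminus / (8 * (d + 1))) (1 / 8) / ((ℓ : ℝ) * (ℓ + 1) / 2)) (a2minus / ((ℓ : ℝ) + 1) ^ 2))
      (|aplus| + aplus ^ 2 * C + |a2plus| * Real.exp (κ * ℓ)) κ := by
  have hℓ1 : (1 : ℝ) ≤ ℓ := by exact_mod_cast hℓ
  have hP : (0 : ℝ) < (ℓ : ℝ) * (ℓ + 1) / 2 := by positivity
  have ha₁ : 0 < a := lt_of_lt_of_le ham h1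
  have ha₂ : 0 ≤ a₂ := le_trans ha2m.le h5
  refine ⟨covOpG_isSymm T hTs a a₂, fun v => ?_, fun p q => ?_⟩
  · have hge := covOpG_form_ge T hn hℓ ha₁ ha₂ hTG hlev v
    have hγle : min (min (aminus / (8 * (d + 1))) (1 / 8) / ((ℓ : ℝ) * (ℓ + 1) / 2)) (a2minus / ((ℓ : ℝ) + 1) ^ 2) ≤
        min (min (a / (8 * (d + 1))) (1 / 8) / ((ℓ : ℝ) * (ℓ + 1) / 2)) (a₂ / ((ℓ : ℝ) + 1) ^ 2) := by
      apply min_le_min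
      · apply div_le_div_of_nonneg_right _ hP.le
        exact min_le_min (div_le_div_of_nonneg_right h1 (by positivity)) le_rfl
      · exact div_le_div_of_nonneg_right h5 (by positivity)
    have hvv : ∑ p, v p ^ 2 = v ⬝ᵥ v := by
      unfold dotProduct
      exact Finset.sum_congr rfl fun p _ => by ring
    have hvv0 : 0 ≤ v ⬝ᵥ v := by
      rw [← hvv]
      exact Finset.sum_nonneg fun _ _ => sq_nonneg _
    rw [hvv]
    show _ * (v ⬝ᵥ v) ≤ v ⬝ᵥ (covOpG n ℓ M' a a₂ T).mulVec v
    exact (mul_le_mul_of_nonneg_right hγle hvv0).trans hge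
  · have hKe := KeffG_entry_bound T hn hρ ha₁ hrow p q
    have hPe := blockAvgP_entry_bound ℓ M' hκ.le p q
    have hE := Real.exp_pos (-(κ * ρ p q))
    have hPe' : |blockAvgP ℓ M' p q| ≤ Real.exp (κ * ℓ) * Real.exp (-(κ * ρ p q)) :=
      hPe.trans (mul_le_mul_of_nonneg_left (Real.exp_le_exp.2 (by nlinarith [hρle p q, hκ.le])) (Real.exp_pos _).le)
    have hL2 : a₂ / ((ℓ : ℝ) + 1) ^ 2 ≤ |a2plus| :=
      calc a₂ / ((ℓ : ℝ) + 1) ^ 2 ≤ a₂ := div_le_self ha₂ (one_le_pow₀ (by linarith))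
        _ ≤ a2plus := h6
        _ ≤ |a2plus| := le_abs_self _
    have hK2 : a + a ^ 2 * C ≤ |aplus| + aplus ^ 2 * C := by
      have hsq : a ^ 2 ≤ aplus ^ 2 := pow_le_pow_left₀ ha₁.le h2 2
      have habs : a ≤ |aplus| := h2.trans (le_abs_self _)
      nlinarith
    have hentry : covOpG n ℓ M' a a₂ T p q = KeffG n (fun i => (ℓ + 1) * M' i) a T p q + a₂ / ((ℓ : ℝ) + 1) ^ 2 * blockAvgP ℓ M' p q := by
      simp only [covOpG, Matrix.add_apply, Matrix.smul_apply, smul_eq_mul]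
    rw [hentry]
    calc |KeffG n (fun i => (ℓ + 1) * M' i) a T p q + a₂ / ((ℓ : ℝ) + 1) ^ 2 * blockAvgP ℓ M' p q|
        ≤ |KeffG n (fun i => (ℓ + 1) * M' i) a T p q| + |a₂ / ((ℓ : ℝ) + 1) ^ 2 * blockAvgP ℓ M' p q| := abs_add_le _ _
      _ ≤ (a + a ^ 2 * C) * Real.exp (-(κ * ρ p q)) + a₂ / ((ℓ : ℝ) + 1) ^ 2 * (Real.exp (κ * ℓ) * Real.exp (-(κ * ρ p q))) := by
          refine add_le_add hKe ?_
          rw [abs_mul, abs_of_nonneg (by positivity : (0 : ℝ) ≤ a₂ / ((ℓ : ℝ) + 1) ^ 2)]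
          exact mul_le_mul_of_nonneg_left hPe' (by positivity)
      _ ≤ (|aplus| + aplus ^ 2 * C) * Real.exp (-(κ * ρ p q)) + |a2plus| * (Real.exp (κ * ℓ) * Real.exp (-(κ * ρ p q))) :=
          add_le_add (mul_le_mul_of_nonneg_right hK2 hE.le) (mul_le_mul_of_nonneg_right hL2 (by positivity))
      _ = (|aplus| + aplus ^ 2 * C + |a2plus| * Real.exp (κ * ℓ)) * Real.exp (-(κ * ρ p q)) := by ring

/-- **COMBES–THOMAS DECAY OF `(Δ_T + a₂L_P^{−2}P)⁻¹` IN THE PSEUDO-DISTANCE** (`B4Sect5Torus.inv_decay` BY NAME): with `γ₀, c₀` as in `covOpG_hyp56`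
and a lattice-sum profile `K` of `ρ`, `|(Δ_T + a₂L_P^{−2}P)⁻¹(y,y′)| ≤ (2∕γ₀)·e^{−rate(K,γ₀,c₀,κ)·ρ(y,y′)}`. [folklore] -/
theorem covOpG_inv_decay (hn : 1 ≤ n) (hℓ : 1 ≤ ℓ) {ρ : ↥(boxDom fun i => (ℓ + 1) * M' i) → ↥(boxDom fun i => (ℓ + 1) * M' i) → ℝ}
    (hρ : IsPseudoDist ρ) (hρle : ∀ y y', ρ y y' ≤ supNorm (y.1 - y'.1)) {K : ℝ → ℝ} (hK : ∀ t, 0 < t → 0 ≤ K t)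
    (hS : SumBound ρ K) {C κ : ℝ} (hC : 0 ≤ C) (hκ : 0 < κ)
    {aminus aplus a2minus a2plus a a₂ : ℝ} (ham : 0 < aminus) (h1 : aminus ≤ a) (h2 : a ≤ aplus) (ha2m : 0 < a2minus)
    (h5 : a2minus ≤ a₂) (h6 : a₂ ≤ a2plus) (hTs : T.IsSymm) (hTG : T * T⁻¹ = 1)
    (hlev : ∀ g, g ⬝ᵥ (boxOpR n a 0 (fun i => (ℓ + 1) * M' i)).mulVec g ≤ g ⬝ᵥ T.mulVec g)
    (hrow : ∀ (x : ↥(boxDom fun i => n * ((ℓ + 1) * M' i))) (y y' : ↥(boxDom fun i => (ℓ + 1) * M' i)), blk n x.1 = y.1 →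
      |∑ x' ∈ Finset.univ.filter (fun x' : ↥(boxDom fun i => n * ((ℓ + 1) * M' i)) => blk n x'.1 = y'.1), T⁻¹ x x'|
        ≤ C * Real.exp (-(κ * ρ y y')))
    (y y' : ↥(boxDom fun i => (ℓ + 1) * M' i)) :
    |(covOpG n ℓ M' a a₂ T)⁻¹ y y'| ≤
      2 / (min (min (aminus / (8 * (d + 1))) (1 / 8) / ((ℓ : ℝ) * (ℓ + 1) / 2)) (a2minus / ((ℓ : ℝ) + 1) ^ 2)) *
        Real.exp (-(rate K (min (min (aminus / (8 * (d + 1))) (1 / 8) / ((ℓ : ℝ) * (ℓ + 1) / 2)) (a2minus / ((ℓ : ℝ) + 1) ^ 2))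
          (|aplus| + aplus ^ 2 * C + |a2plus| * Real.exp (κ * ℓ)) κ * ρ y y')) := by
  have hℓ1 : (1 : ℝ) ≤ ℓ := by exact_mod_cast hℓ
  have hγ : 0 < min (min (aminus / (8 * (d + 1))) (1 / 8) / ((ℓ : ℝ) * (ℓ + 1) / 2)) (a2minus / ((ℓ : ℝ) + 1) ^ 2) :=
    lt_min (by positivity) (by positivity)
  have hc : 0 ≤ |aplus| + aplus ^ 2 * C + |a2plus| * Real.exp (κ * ℓ) := by positivity
  exact inv_decay hK hγ hc hκ hρ hS (covOpG_hyp56 T hn hℓ hρ hρle hC hκ ham h1 h2 ha2m h5 h6 hTs hTG hlev hrow) y y'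

end DecayCov

end Summit.QuantumFields.BalabanUV.T4Continuum.NE7K1LinCovDecayAbstract

end
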